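import Summits.AtomisticToContinuum.FouriersLaw.Theses.PhononMeanFreePath
import Summits.AtomisticToContinuum.FouriersLaw.Theorems.PhononMeanFreePathDefs

/-! Census scratch (strategist s1): the sign × tightness split of `CoherentDephasing`, TYPED (not filed). -/

noncomputable section
open MeasureTheory Set Filter Topology
namespace Summit.AtomisticToContinuum.FouriersLaw.Cruxes.CoherentDephasing.CensusSplit
open Literature.MathematicalPhysics.KineticTheory.HeatConduction (pinnedChain PhaseSpace)
open Summit.AtomisticToContinuum.FouriersLaw.Theses.PhononMeanFreePath (CoherentDephasing)
open Summit.AtomisticToContinuum.FouriersLaw.Theorems.PhononMeanFreePath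

/-- BLOCK PASSIVITY beyond the head + work-passivity of the last block (sign statement, rate-free, `κ`-free;
true with equality at `lam = β = 0`). -/
def BlockPassivity : Prop :=
  ∀ ω₂ lam β γ : ℝ, 0 < ω₂ → 0 < lam → 0 < β → 0 < γ → ∀ T : ℝ, 0 < T →
    ∃ L₀ L N₀ : ℕ, 0 < L₀ ∧ ∀ N : ℕ, N₀ ≤ N →
      (∀ (x : ℕ) (hx : x + L₀ ≤ N + 1), L ≤ x →
        0 ≤ ∑ i : Fin L₀, (siteWork ω₂ lam β γ T N ⟨x + i, by omega⟩ +
          γ * ((if x + (i : ℕ) = 0 then 1 else 0) + (if x + (i : ℕ) = N then 1 else 0)) *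
            ∫ t in Set.Ioi (0 : ℝ), momResp ω₂ lam β γ T N ⟨x + i, by omega⟩ t ^ 2)) ∧
      (∀ hL : L₀ ≤ N + 1, 0 ≤ ∑ i : Fin L₀, siteWork ω₂ lam β γ T N ⟨N + 1 - L₀ + i, by omega⟩)

/-- COHERENT TIGHTNESS: the time-integrated coherent energy profile is tight, uniformly in the length
(rate-free, sign-free; false at `lam = β = 0`). -/
def CoherentTightness : Prop :=
  ∀ ω₂ lam β γ : ℝ, 0 < ω₂ → 0 < lam → 0 < β → 0 < γ → ∀ T : ℝ, 0 < T →
    ∀ ε : ℝ, 0 < ε → ∃ M N₀ : ℕ, ∀ N : ℕ, N₀ ≤ N →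
      ∑ x : Fin (N + 1), (if M ≤ (x : ℕ) then cohEnergy ω₂ lam β γ T N x else 0) ≤ ε

/-- The glue (paper-proved in STRATEGY-CENSUS.md §Decomposition; NOT landed): monotone block-boundary fluxes +
last-block work-passivity + transport bound + Cesàro over the boundaries in `[N/2, N]`. -/
theorem coherentDephasing_of_passivity_of_tightness :
    BlockPassivity → CoherentTightness → CoherentDephasing := by
  sorry

end Summit.AtomisticToContinuum.FouriersLaw.Cruxes.CoherentDephasing.CensusSplit
end
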